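import Summits.ABC.IUTFork.Thm311RealInd2Ism
import HarnessLib

/-!
# [IUTchIII] Theorem 3.11 (i) (Ind2), print-literal at `𝕍^non`: the real signature `Real.logShellsIsm` and the
# packet-level MONOTONICITY «(Ind1,Ind2)-group over print's Ism ≤ the one over Dupuy–Hilado's»

Record file (D-0012) of the abc-iut cell (seat abc-iut-c312-1, holder of record of the typed [IUTchIII] Thm. 3.11, gen 7);
sequel of `Thm311RealInd2Ism.lean` (print's nonarchimedean (Ind2)-group `Real.ismIsm logv v ⊆ Real.ismDH logv (inr v)`).
TAKES NO SIDE on [IUTchIII] Cor. 3.12.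

TYPED: `Real.ismPrint logv` — the (Ind2)-binder that is print's `ismIsm` at the finite places and c312-5's `ismDH`
(`{1, −1}`) at the infinite ones (abc-iut-w4-d001's `ismPrintArch`, p-file `Thm311RealArchInd2Print`, enlarges the latter
to print's Klein four-group; the two refinements are independent and not merged here); `Real.logShellsIsm X logv` —
c312-5's real `Thm311.LogShells` with THIS (Ind2)-slot (strip slot `stripAutDH`, log-binder `logv`, unchanged).
PROVED: `Real.ismPrint_subset_ismDH` (place by place), `Real.Ind2_mono` (the (Ind2)-sets of every tensor packet are
monotone in the binder), `Real.Ind2_ismPrint_subset_Ind2_ismDH`, `Real.Ind2Family_ismPrint_subset`,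
`Real.Ind1Family_ismPrint_eq` (rfl), **`Real.indGroup_ismPrint_le`**: the indeterminacy group `⟨(Ind1) ∪ (Ind2)⟩`
(abc-iut-c312-1 `LogShells.IndGroup`, Thm311Pilot) over print's (Ind2) is a subgroup of the one over DH's — so unions of
possible images and holomorphic hulls over DH's group CONTAIN those over print's (hull operators are monotone), every
`∀`-clause over DH's group (log-volume invariance, the typed Thm 3.11 premise) restricts, and every countermodel of
record whose DH-hull is too small for the (xi-f) licence / `Cor312.Setting.Statement` remains one under print's
reading ([IUTchIII] Thm. 3.11 (i) (Ind2) p. 154 l. 55–60; Dupuy–Hilado §4.9).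
[claim: Mochizuki2012, status: disputed] [cite: DupuyHilado2025, §4.9]. typed ≠ proved; instantiated ≠ endorsed.
-/

set_option autoImplicit false

noncomputable section

namespace Summit.ABC.IUTFork.Thm311.Real

open NumberField IsDedekindDomain Literature.IUT.LogVolume Literature.IUT.LogThetaLattice

variable {F : Type} [Field F] [NumberField F] (X : PilotData F) (logv : PadicLogs F)

/-! ## 4. On c312-5's real signature: print's nonarchimedean (Ind2) `⊆ Real.ismDH` -/


/-- **PRINT'S (Ind2)-GROUP AT THE FINITE PLACE `v` OF THE REAL SIGNATURE**: `ismIsmOf` for c312-5's log-binder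
`logv v` (`Real.Carrier (inr v) = v.adicCompletion F`, `Real.integers v = v.adicCompletionIntegers F` by `rfl`).
[claim: Mochizuki2012, status: disputed] -/
def ismIsm (logv : PadicLogs F) (v : HeightOneSpectrum (𝓞 F)) :
    Set (Carrier (.inr v : Place F) ≃ₗ[ℚ] Carrier (.inr v : Place F)) :=
  {ψ | (ψ.toAddEquiv : v.adicCompletion F ≃+ v.adicCompletion F) ∈ ismIsmOf v (logv v)}

/-- Membership unfolded. [folklore] -/
theorem mem_ismIsm_iff (v : HeightOneSpectrum (𝓞 F)) (ψ : Carrier (.inr v : Place F) ≃ₗ[ℚ] Carrier (.inr v : Place F)) :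
    ψ ∈ ismIsm logv v ↔ (ψ.toAddEquiv : v.adicCompletion F ≃+ v.adicCompletion F) ∈ ismIsmOf v (logv v) := Iff.rfl

/-- `1 ∈ Real.ismIsm logv v`. [folklore] -/
theorem refl_mem_ismIsm (v : HeightOneSpectrum (𝓞 F)) :
    LinearEquiv.refl ℚ (Carrier (.inr v : Place F)) ∈ ismIsm logv v :=
  refl_mem_ismIsmOf v (logv v)

/-- **`−1 ∈ Real.ismIsm logv v`** (non-vacuity at every finite place). [claim: Mochizuki2012, status: disputed] -/
theorem neg_mem_ismIsm (v : HeightOneSpectrum (𝓞 F)) : LinearEquiv.neg ℚ ∈ ismIsm logv v :=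
  neg_mem_ismIsmOf v (logv v)

/-- **PRINT'S (Ind2) ACTS THROUGH DUPUY–HILADO'S**: `Real.ismIsm logv v ⊆ Real.ismDH logv (inr v)` — every automorphism
of `K_v` induced by a `G_v`-isometry of [IUTchII] Ex. 1.8 (iv) is a bicontinuous `ℚ`-linear `φ` with `φ(I_v) = I_v`
(Dupuy–Hilado §4.9 «These indeterminacies … act through the group `Aut_{ℚ_p}(K_v : I_v)`», as a kernel theorem about
the cell's two typings).  Hence every `∀`-statement over `ismDH` and every hull/orbit COUNTERMODEL formed over `ismDH`
holds verbatim for print's group. [cite: DupuyHilado2025, §4.9] [claim: Mochizuki2012, status: disputed] -/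
theorem ismIsm_subset_ismDH (v : HeightOneSpectrum (𝓞 F)) : ismIsm logv v ⊆ ismDH logv (.inr v : Place F) := by
  intro ψ hψ
  exact ⟨hψ.1, hψ.2.1, image_shell_eq_of_mem_ismIsmOf v (logv v) (residueChar F v) hψ⟩



/-- The (Ind2)-binder that is print's `ismIsm` at the finite places and c312-5's `ismDH` (`{1, −1}`) at the infinite
places (abc-iut-w4-d001's `ismPrintArch` enlarges the latter to print's Klein four-group; not repeated here).
[claim: Mochizuki2012, status: disputed] -/
def ismPrint (logv : PadicLogs F) : ∀ x : Place F, Set (Carrier x ≃ₗ[ℚ] Carrier x)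
  | .inl w => ismDH logv (.inl w)
  | .inr v => ismIsm logv v

/-- The identity lies in the binder at every place. [folklore] -/
theorem refl_mem_ismPrint (x : Place F) : LinearEquiv.refl ℚ (Carrier x) ∈ ismPrint logv x := by
  cases x with
  | inl w => exact refl_mem_ismDH logv (.inl w)
  | inr v => exact refl_mem_ismIsm logv v

/-- **Print's nonarchimedean (Ind2) ⊆ the typed DH (Ind2), place by place.** [cite: DupuyHilado2025, §4.9] -/
theorem ismPrint_subset_ismDH (x : Place F) : ismPrint logv x ⊆ ismDH logv x := by
  cases x with
  | inl w => exact subset_rfl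
  | inr v => exact ismIsm_subset_ismDH logv v

/-- **`Thm311.LogShells` with PRINT'S nonarchimedean (Ind2)**: c312-5's real signature with the trivialised strip slot
`stripAutDH` and the (Ind2)-slot `ismPrint`. [claim: Mochizuki2012, status: disputed] -/
def logShellsIsm : LogShells (thetaIndex X) :=
  logShells X logv stripAutDH (ismPrint logv) refl_mem_stripAutDH (refl_mem_ismPrint logv)

/-- MONOTONICITY of (Ind2) in the binder, for the real signature: a smaller (Ind2)-slot gives fewer (Ind2)-automorphisms
of every tensor packet. [folklore] -/
theorem Ind2_mono {Ism Ism' : ∀ x : Place F, Set (Carrier x ≃ₗ[ℚ] Carrier x)}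
    (hI : ∀ x, LinearEquiv.refl ℚ (Carrier x) ∈ Ism x) (hI' : ∀ x, LinearEquiv.refl ℚ (Carrier x) ∈ Ism' x)
    (hle : ∀ x, Ism x ⊆ Ism' x) (j : (thetaIndex X).Label) (vQ : (thetaIndex X).VQ) :
    (logShells X logv stripAutDH Ism refl_mem_stripAutDH hI).Ind2 j vQ ⊆
      (logShells X logv stripAutDH Ism' refl_mem_stripAutDH hI').Ind2 j vQ := by
  rintro φ ⟨g, hg, rfl⟩
  exact ⟨g, fun i w => hle _ (hg i w), rfl⟩

/-- **(Ind2) over print's group ⊆ (Ind2) over DH's group**, on every tensor packet `I^ℚ(^{S±_{j+1}}𝒟⊢_{v_ℚ})`.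
[cite: DupuyHilado2025, §4.9] [claim: Mochizuki2012, status: disputed] -/
theorem Ind2_ismPrint_subset_Ind2_ismDH (j : (thetaIndex X).Label) (vQ : (thetaIndex X).VQ) :
    (logShellsIsm X logv).Ind2 j vQ ⊆ (logShellsDH X logv).Ind2 j vQ :=
  Ind2_mono X logv (refl_mem_ismPrint logv) (refl_mem_ismDH logv) (ismPrint_subset_ismDH logv) j vQ

/-- The same for the (Ind2)-families. [claim: Mochizuki2012, status: disputed] -/
theorem Ind2Family_ismPrint_subset :
    (logShellsIsm X logv).Ind2Family ⊆ (show Set (logShellsIsm X logv).PacketAut from (logShellsDH X logv).Ind2Family) :=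
  fun _ hΦ j vQ => Ind2_ismPrint_subset_Ind2_ismDH X logv j vQ (hΦ j vQ)

/-- (Ind1) is unchanged (same strip slot). [folklore] -/
theorem Ind1Family_ismPrint_eq :
    (logShellsIsm X logv).Ind1Family = (show Set (logShellsIsm X logv).PacketAut from (logShellsDH X logv).Ind1Family) :=
  rfl

/-- **The indeterminacy group `⟨(Ind1) ∪ (Ind2)⟩` over print's (Ind2) lies in the one over DH's** — so every union of
possible images / holomorphic hull formed over DH's group CONTAINS the one formed over print's group (hulls are
monotone), and every countermodel of record whose hull over `ismDH` is too small stays a countermodel under print's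
reading. [cite: DupuyHilado2025, §4.9] [claim: Mochizuki2012, status: disputed] -/
theorem indGroup_ismPrint_le :
    (logShellsIsm X logv).IndGroup ≤ (show Subgroup (logShellsIsm X logv).PacketAut from (logShellsDH X logv).IndGroup) := by
  change Subgroup.closure _ ≤ Subgroup.closure _
  refine Subgroup.closure_mono ?_
  rintro Φ (hΦ | hΦ)
  · exact Or.inl (by rw [Ind1Family_ismPrint_eq] at hΦ; exact hΦ)
  · exact Or.inr (Ind2Family_ismPrint_subset X logv hΦ)

end Summit.ABC.IUTFork.Thm311.Real

end
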